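import Literature.Analysis.FunctionSpaces.ItoProcessesProofs
import Literature.Analysis.FunctionSpaces.SquaredBesselExistence
import Literature.Probability.Process.ItoIntegralNegation
import Literature.Probability.RandomPlanarGeometry.LocalMartingaleProofs
import Literature.Probability.RandomPlanarGeometry.LoewnerFlow
import HarnessLib

/-!
# The SLE–Bessel bridge: reduction of `Literature.Analysis.FunctionSpaces.sle_bessel` to the Bessel SDE before `T₀`

Topic `Analysis/FunctionSpaces`; sibling file of
`Literature/Analysis/FunctionSpaces/ItoProcesses.lean`, working towards the discharge
`sle_bessel_holds` of the named fact `Literature.Analysis.FunctionSpaces.sle_bessel` (Rohde–Schramm 2005, §6, remark after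
Lemma 6.2: for chordal SLE_κ with driving function `Wₜ = √κ Bₜ` and a real point `x > 0`,
`(gₜ(x) - Wₜ)/√κ` is a Bessel process of dimension `1 + 4/κ` up to the swallowing time `T_x`;
Lawler (2005), §6.1, eq. (6.2)–(6.3): `ĝₜ = (gₜ - √κ Bₜ)/√κ` satisfies
`dĝₜ = (2/κ) ĝₜ⁻¹ dt + dWₜ` with `Wₜ = -Bₜ`).

## The printed proof and its architecture here

The sources *define* the Bessel process through its SDE up to the hitting time of `0`
(Lawler, §1.10: "`X_t = x + B_t + a ∫₀ᵗ ds/X_s` if `t ≤ T_x`", `a = (d-1)/2`), so that the remark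
is the one-line pathwise observation `dY_x = (2/Y_x) dt + dξ` (Rohde–Schramm, proof of Lemma 6.2;
Lawler (6.3)). The fact `Literature.Analysis.FunctionSpaces.sle_bessel` instead uses Revuz–Yor's notion
(`Literature.Analysis.FunctionSpaces.IsBesselProcess`: the square root of a *global* squared Bessel process `BESQ^δ(x₀²)`,
Revuz–Yor Ch. XI, Def. (1.1), Def. (1.9)) and asks for such a process, driven by `-B` on the
canonical space with its raw Brownian filtration, agreeing with `(gₜ(x) - Wₜ)/√κ` before `T_x`.
Bridging the two notions is the whole content, and it splits as follows
(`W = √κ B`, `δ = 1 + 4/κ`, `x₀ = x/√κ`, `z₀ = x₀²`):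

* **E** (proved here, `exists_isSquaredBesselProcess_neg_brownian`): existence of a squared
  Bessel process `Z = BESQ^δ(z₀)` driven by `-B`, adapted to the raw Brownian filtration. The map
  `Z ↦ -Z` exchanges the squared Bessel equations driven by `B` and by `-B`
  (`IsSquaredBesselProcess.neg`: `d(-Z) = (-δ) dt + 2√|-Z| d(-B)` since `|-z| = |z|`, with the
  sign rules `IsItoIntegral.neg_right` of `ItoIntegralNegation`), so E is the existence theorem
  `exists_isSquaredBesselProcess` of `SquaredBesselExistence` (Revuz–Yor XI §1, Def. (1.1);
  proved there for *all real* `δ, z₀` by the Euler–Maruyama scheme) at `(-δ, -z₀)`.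
* **S** (hypothesis `hS` of `sle_bessel_of_sqrt_eq`; Revuz–Yor XI §1, p. 446 with IV
  Thm (3.3)): Itô's formula for `√·` along `Z` before it reaches `0`: a.s., for every `t` with
  `Z > 0` on `[0, t]`, `√Zₜ = √z₀ - Bₜ + ((δ-1)/2) ∫₀ᵗ ds/√Z_s` — i.e. `ρ = √Z` solves the
  Bessel SDE driven by `-B` before `T₀`, which is Lawler's defining equation. It is discharged
  from Itô's formula for Itô processes (`Literature.Analysis.FunctionSpaces.ito_formula_itoProcess_ae`) in the sibling file
  `SLEBesselIto`.
* **Deterministic core** (proved here, `Loewner.pos_and_eq_re_map_sub_of_flowEq`): if a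
  continuous `y : ℝ≥0 → ℝ` with `y 0 = x > 0 = W 0` satisfies
  `y t + W t = x + ∫₀ᵗ 2/y(s) ds` whenever `y > 0` on `[0, t]`, then for every `t < T_x`:
  `y > 0` on `[0, t]` and `y t = Re gₜ(x) - W t`. Indeed `u = y + W` solves the Loewner ODE
  `u̇ = 2/(u - W)` from `x` as long as `y > 0` (fundamental theorem of calculus), so it *is* the
  Loewner flow of `x` there (uniqueness, `Loewner.IsSolution.eqOn_holds`, and
  `Loewner.map_eq_of_isSolution`); and `y` cannot vanish at a time `s₀ ≤ t < T_x`, because the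
  flow of `x` is alive and off the driving function at `s₀` while `u(s₀) = W(s₀)`.
* **Assembly** (proved here, `sle_bessel_of`, `sle_bessel_of_sqrt_eq`): with `y = √κ √Z` the
  hypothesis of the core is **S** multiplied by `√κ` (`√κ (δ-1)/2 = 2/√κ`, `2/y = (2/√κ)/√Z`),
  along the a.s. continuous paths of `Z` (`IsStrongSolution.ae_continuous`); `ρ = √Z` is the
  Bessel process of `sle_bessel` by definition of `IsBesselProcess`.

## References

* S. Rohde, O. Schramm, *Basic properties of SLE*, Ann. of Math. 161 (2005), 883–924, §6,
  Lemma 6.2 and the remark before its proof; proof of Lemma 6.2 (`dY_x = (2/Y_x) dt + dξ`).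
* G. F. Lawler, *Conformally Invariant Processes in the Plane*, AMS (2005), §1.10 (Bessel-`d`
  process: `dX = (a/X) dt + dB`, `a = (d-1)/2`, up to `T_x`), §6.1 eq. (6.2)–(6.3) and
  Remark 6.6, §6.2 Prop. 6.8.
* D. Revuz, M. Yor, *Continuous Martingales and Brownian Motion* (3rd ed., 1999), Ch. IV
  eq. (2.4), Prop. (2.10)(i), Thm (3.3) (Itô's formula); Ch. IX Def. (1.2); Ch. XI §1, Def. (1.1)
  (p. 439), Def. (1.9) (p. 445), and the display after it (p. 446):
  "`X_t^{1/2} = √x + β_t + ((δ-1)/2) ∫₀ᵗ X_s^{-1/2} ds` … BES^δ(a), `a > 0`, is a solution to the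
  SDE `ρ_t = a + β_t + ((δ-1)/2) ∫₀ᵗ ρ_s⁻¹ ds`".
-/

open MeasureTheory ProbabilityTheory Filter Set
open scoped NNReal ENNReal Topology

noncomputable section

namespace Literature.Analysis.FunctionSpaces

variable {Ω : Type*} {m : MeasurableSpace Ω}

/-! ### Squared Bessel processes driven by `-B` -/

section NegDriver

variable {δ z₀ : ℝ} {Z B : ℝ≥0 → Ω → ℝ} {𝓕 : Filtration ℝ≥0 m} {P : Measure Ω}

/-- **`Z ↦ -Z` exchanges the squared Bessel equations driven by `B` and by `-B`.** If `Z` is a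
solution adapted to `𝓕` of `dZ = δ dt + 2√|Z| dB`, `Z₀ = z₀`, then `-Z` is a solution adapted to
`𝓕` of `d(-Z) = (-δ) dt + 2√|-Z| d(-B)`, `(-Z)₀ = -z₀`: the diffusion coefficient `2√|z|` is
even, and `∫ 2√|Z| d(-B) = -∫ 2√|Z| dB` (`IsItoIntegral.neg_right`). For `δ, z₀ ≥ 0` the process
`-Z ≤ 0` is the (unique strong) solution of the squared Bessel equation with the *negative*
parameters `(-δ, -z₀)`, which Revuz–Yor's "for every `δ` and `x`, this equation has a unique
strong solution" (Ch. XI, §1, p. 439) also covers.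
Revuz–Yor, *Continuous Martingales and Brownian Motion* (1999), Ch. XI, §1, Def. (1.1) and
p. 439; Ch. IX, Def. (1.2); Ch. IV, eq. (2.4). [folklore] -/
theorem IsSquaredBesselProcess.neg (h : IsSquaredBesselProcess δ z₀ Z B 𝓕 P) :
    IsSquaredBesselProcess (-δ) (-z₀) (fun t ω ↦ -Z t ω) (fun t ω ↦ -B t ω) 𝓕 P := by
  obtain ⟨h0, ha, hint, J, hJ, heq⟩ := h
  refine ⟨fun ω ↦ by simp only [h0 ω], fun t ↦ (ha t).neg, ?_, fun t ω ↦ -J t ω, ?_, ?_⟩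
  · exact ae_of_all _ fun ω t ↦
      integrableOn_const (measure_Icc_lt_top (a := (0 : ℝ)) (b := (t : ℝ))).ne
  · have h1 := hJ.neg_right
    have h2 : (fun s ω ↦ (fun (_ : ℝ≥0) (z : ℝ) ↦ 2 * Real.sqrt |z|) s ((fun t ω ↦ -Z t ω) s ω)) =
        fun s ω ↦ (fun (_ : ℝ≥0) (z : ℝ) ↦ 2 * Real.sqrt |z|) s (Z s ω) := by
      funext s ω
      simp only [abs_neg]
    rw [h2]
    exact h1
  · filter_upwards [heq] with ω hω t
    have := hω t
    simp only [intervalIntegral.integral_const, smul_eq_mul] at this ⊢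
    linarith

end NegDriver

/-- **Existence of squared Bessel processes driven by `-B`** (fact **E** of the bridge): for all
real `δ, z₀` there is a solution `Z` of `dZ = δ dt + 2√|Z| d(-B)`, `Z₀ = z₀`, on the canonical
space, adapted to the raw Brownian filtration — namely `Z = -Y` for the squared Bessel process
`Y = BESQ^{-δ}(-z₀)` driven by `B` of `exists_isSquaredBesselProcess` (Euler–Maruyama
construction, valid for all real parameters) and `IsSquaredBesselProcess.neg`.
Revuz–Yor, *Continuous Martingales and Brownian Motion* (1999), Ch. XI, §1 (p. 439: "for every
`δ` and `x`, this equation has a unique strong solution") and Def. (1.1), for the `(ℱₜ)`-Brownian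
motion `-B` (Ch. III, Def. (2.20)). [cite: RevuzYor1999, Ch. XI §1 Def. (1.1)] -/
theorem exists_isSquaredBesselProcess_neg_brownian (δ z₀ : ℝ) :
    ∃ Z : ℝ≥0 → (ℝ≥0 → ℝ) → ℝ, IsSquaredBesselProcess δ z₀ Z (fun t ω ↦ -Literature.Probability.Process.brownian t ω)
      Literature.Probability.RandomPlanarGeometry.brownianFiltration Literature.Probability.Process.preWienerMeasure := by
  obtain ⟨Y, hY⟩ := exists_isSquaredBesselProcess (-δ) (-z₀)
  refine ⟨fun t ω ↦ -Y t ω, ?_⟩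
  have := hY.neg
  simpa only [neg_neg] using this


/-! ### Deterministic core: a positive solution of the flow equation is the Loewner flow -/

namespace Loewner

variable {W : ℝ≥0 → ℝ} {x : ℝ} {y : ℝ≥0 → ℝ}

/-- The candidate Loewner flow `u(r) = y(r) + W(r)` of a real point, as a complex curve on `ℝ`
(real time clamped to `ℝ≥0` through `Real.toNNReal`, as in `Loewner.IsSolution`). [folklore] -/
def flowCurve (W y : ℝ≥0 → ℝ) (r : ℝ) : ℂ :=
  ((y r.toNNReal + W r.toNNReal : ℝ) : ℂ)

/-- Unfolding lemma for `flowCurve`. [folklore] -/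
theorem flowCurve_apply (W y : ℝ≥0 → ℝ) (r : ℝ) :
    flowCurve W y r = ((y r.toNNReal + W r.toNNReal : ℝ) : ℂ) := rfl

/-- **The flow equation produces Loewner solutions.** If `y` is continuous, positive on
`[0, t')`, `y 0 + W 0 = x`, and `y r + W r = x + ∫₀ʳ 2/y(s) ds` whenever `y > 0` on `[0, r]`,
then `u = y + W` solves the chordal Loewner equation `u̇ = 2/(u - W)` started at `x` with lifetime
`t'` (fundamental theorem of calculus for the continuous integrand `2/y` on `[0, t')`).
Lawler (2005), §6.1, eq. (6.3) read backwards; Rohde–Schramm (2005), proof of Lemma 6.2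
(`dY_x = (2/Y_x) dt + dξ`). [folklore] -/
theorem isSolution_flowCurve (hy : Continuous y) (h0 : y 0 + W 0 = x) {t' : ℝ≥0}
    (hpos : ∀ s < t', 0 < y s)
    (hflow : ∀ t : ℝ≥0, (∀ s ≤ t, 0 < y s) →
      y t + W t = x + ∫ s in (0 : ℝ)..t, 2 / y s.toNNReal) :
    Literature.Probability.RandomPlanarGeometry.Loewner.IsSolution W x (flowCurve W y) t' := by
  -- the integrand and its primitive
  set f : ℝ → ℝ := fun s ↦ 2 / y s.toNNReal with hf
  set F : ℝ → ℝ := fun r ↦ x + ∫ s in (0 : ℝ)..r, f s with hF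
  have hyc : Continuous fun s : ℝ ↦ y s.toNNReal := hy.comp continuous_real_toNNReal
  have hfm : Measurable f := measurable_const.div hyc.measurable
  -- the open set of real times before `t'`
  set U : Set ℝ := {s : ℝ | s.toNNReal < t'} with hU
  have hUo : IsOpen U := isOpen_lt continuous_real_toNNReal continuous_const
  have hfU : ∀ s ∈ U, ContinuousAt f s := fun s hs ↦
    (continuousAt_const.div hyc.continuousAt (hpos _ hs).ne')
  have hD : ∀ r : ℝ, 0 ≤ r → (r.toNNReal : WithTop ℝ≥0) < t' → r ∈ U := fun r _ hr ↦ by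
    simpa [hU] using WithTop.coe_lt_coe.1 hr
  -- on `[0, t')` the curve is the primitive
  have hflow' : ∀ r : ℝ, 0 ≤ r → (r.toNNReal : WithTop ℝ≥0) < t' →
      flowCurve W y r = ((F r : ℝ) : ℂ) := by
    intro r hr0 hr
    have hrt : r.toNNReal < t' := by exact_mod_cast hr
    have := hflow r.toNNReal fun s hs ↦ hpos s (hs.trans_lt hrt)
    rw [flowCurve_apply, this, Real.coe_toNNReal _ hr0]
  -- the primitive is differentiable on `U`
  have hderF : ∀ r ∈ U, HasDerivAt F (f r) r := by
    intro r hr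
    have hIcc : ∀ s ∈ Set.uIcc 0 r, s ∈ U := by
      intro s hs
      rcases le_total 0 r with h | h
      · rw [Set.uIcc_of_le h] at hs
        exact lt_of_le_of_lt (Real.toNNReal_le_toNNReal hs.2) hr
      · rw [Set.uIcc_of_ge h] at hs
        have : s.toNNReal = 0 := Real.toNNReal_of_nonpos hs.2
        show s.toNNReal < t'
        rw [this]
        exact pos_of_gt hr
    have hint : IntervalIntegrable f volume 0 r :=
      (continuousOn_of_forall_continuousAt fun s hs ↦ hfU s (hIcc s hs)).intervalIntegrable
    have h1 : HasDerivAt (fun r ↦ ∫ s in (0 : ℝ)..r, f s) (f r) r :=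
      intervalIntegral.integral_hasDerivAt_right hint
        (hfm.stronglyMeasurable.stronglyMeasurableAtFilter) (hfU r hr)
    simpa [hF] using h1.const_add x
  refine ⟨?_, fun r hr ↦ ?_, fun r hr0 hr ↦ ?_⟩
  · -- initial value
    rw [flowCurve_apply, Real.toNNReal_zero, h0]
  · -- the ODE on `[0, t')`
    have hrU : r ∈ U := hD r hr.1 hr.2
    have h2 : HasDerivAt (fun r ↦ ((F r : ℝ) : ℂ)) ((f r : ℝ) : ℂ) r := (hderF r hrU).ofReal_comp
    have h3 : HasDerivWithinAt (flowCurve W y) ((f r : ℝ) : ℂ)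
        {t : ℝ | 0 ≤ t ∧ (t.toNNReal : WithTop ℝ≥0) < t'} r :=
      h2.hasDerivWithinAt.congr_of_mem (fun s hs ↦ hflow' s hs.1 hs.2) hr
    have hval : Literature.Probability.RandomPlanarGeometry.Loewner.vectorField W r (flowCurve W y r) = ((f r : ℝ) : ℂ) := by
      rw [Literature.Probability.RandomPlanarGeometry.Loewner.vectorField_apply, flowCurve_apply, hf]
      push_cast
      ring
    rw [hval]
    exact h3
  · -- off the singularity
    rw [flowCurve_apply]
    have hrt : r.toNNReal < t' := by exact_mod_cast hr
    have hne : y r.toNNReal ≠ 0 := (hpos _ hrt).ne'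
    intro h
    apply hne
    have := congrArg Complex.re h
    simpa using this

/-- The flow curve is continuous when `y` and `W` are. [folklore] -/
theorem continuous_flowCurve (hW : Continuous W) (hy : Continuous y) :
    Continuous (flowCurve W y) :=
  Complex.continuous_ofReal.comp
    ((hy.comp continuous_real_toNNReal).add (hW.comp continuous_real_toNNReal))

/-- **Positivity before the swallowing time.** Under the flow equation, a continuous `y` with
`y 0 = x > 0 = W 0` stays positive on `[0, t]` for every `t < T_x`: at the first zero `s₀ ≤ t`
of `y`, the curve `u = y + W` is a Loewner solution on `[0, s₀)` (`isSolution_flowCurve`), hence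
agrees there with the flow of `x`, which is alive beyond `s₀` (`s₀ < T_x`) and continuous at
`s₀`; so the flow of `x` sits on the driving function at time `s₀`, `g(s₀) = u(s₀) = W(s₀)`,
contradicting `Loewner.IsSolution.ne`. Lawler (2005), §4.1 (the flow of a real point lives
until it meets the driving function) and Remark 6.6. [folklore] -/
theorem forall_pos_of_flowEq (hW : Continuous W) (hW0 : W 0 = 0) (hx : 0 < x)
    (hy : Continuous y) (hy0 : y 0 = x)
    (hflow : ∀ t : ℝ≥0, (∀ s ≤ t, 0 < y s) →
      y t + W t = x + ∫ s in (0 : ℝ)..t, 2 / y s.toNNReal)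
    {t : ℝ≥0} (ht : (t : WithTop ℝ≥0) < Literature.Probability.RandomPlanarGeometry.Loewner.swallowingTime W x) : ∀ s ≤ t, 0 < y s := by
  have h0 : y 0 + W 0 = x := by rw [hy0, hW0, add_zero]
  -- intermediate values: a nonpositive value before `b` forces a zero before `b`
  have hIVT : ∀ b : ℝ≥0, y b ≤ 0 → ∃ s ≤ b, y s = 0 := by
    intro b hb
    have hmem : (0 : ℝ) ∈ Set.Icc (y b) (y 0) := ⟨hb, by rw [hy0]; exact hx.le⟩
    obtain ⟨s, hs, hys⟩ := intermediate_value_Icc' (zero_le (a := b)) hy.continuousOn hmem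
    exact ⟨s, hs.2, hys⟩
  by_contra hneg
  push Not at hneg
  obtain ⟨s₁, hs₁t, hs₁⟩ := hneg
  obtain ⟨s₂, hs₂, hys₂⟩ := hIVT s₁ hs₁
  -- the first zero `s₀` of `y` in `[0, t]`
  set S : Set ℝ≥0 := Set.Iic t ∩ y ⁻¹' {0} with hS
  have hSc : IsClosed S := isClosed_Iic.inter ((isClosed_singleton).preimage hy)
  have hSne : S.Nonempty := ⟨s₂, hs₂.trans hs₁t, hys₂⟩
  set s₀ := sInf S with hs₀def
  have hs₀ : s₀ ∈ S := hSc.csInf_mem hSne (OrderBot.bddBelow S)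
  have hs₀t : s₀ ≤ t := hs₀.1
  have hys₀ : y s₀ = 0 := hs₀.2
  have hlt : ∀ s < s₀, 0 < y s := by
    intro s hs
    by_contra h'
    push Not at h'
    obtain ⟨s', hs', hys'⟩ := hIVT s h'
    have hs'S : s' ∈ S := ⟨(hs'.trans hs.le).trans hs₀t, hys'⟩
    exact absurd (csInf_le (OrderBot.bddBelow S) hs'S) (not_le.2 (lt_of_le_of_lt hs' hs))
  have hs₀pos : 0 < s₀ := by
    rw [pos_iff_ne_zero]
    rintro h0'
    rw [h0', hy0] at hys₀
    exact hx.ne' hys₀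
  -- the flow of `x` up to `s₀`, and a solution living beyond `s₀`
  have hsol : Literature.Probability.RandomPlanarGeometry.Loewner.IsSolution W x (flowCurve W y) s₀ := isSolution_flowCurve hy h0 hlt hflow
  have hs₀T : (s₀ : WithTop ℝ≥0) < Literature.Probability.RandomPlanarGeometry.Loewner.swallowingTime W x :=
    lt_of_le_of_lt (WithTop.coe_le_coe.2 hs₀t) ht
  rw [Literature.Probability.RandomPlanarGeometry.Loewner.swallowingTime] at hs₀T
  obtain ⟨T', ⟨g, hg⟩, hs₀T'⟩ := lt_sSup_iff.1 hs₀T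
  have heq := Literature.Probability.RandomPlanarGeometry.Loewner.IsSolution.eqOn_holds hW hsol hg
  -- pass to the limit `r ↑ s₀` along `[0, s₀)`
  set r₀ : ℝ := (s₀ : ℝ) with hr₀
  have hr₀pos : 0 < r₀ := by exact_mod_cast hs₀pos
  set E : Set ℝ := Set.Ico 0 r₀ with hE
  have hEsub : E ⊆ {r : ℝ | 0 ≤ r ∧ (r.toNNReal : WithTop ℝ≥0) < min (s₀ : WithTop ℝ≥0) T'} := by
    intro r hr
    have h1 : r.toNNReal < s₀ := (Real.toNNReal_lt_iff_lt_coe hr.1).2 hr.2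
    refine ⟨hr.1, lt_min (by exact_mod_cast h1) ?_⟩
    exact lt_trans (by exact_mod_cast h1) hs₀T'
  have hD' : ∀ r : ℝ, r ∈ {r : ℝ | 0 ≤ r ∧ (r.toNNReal : WithTop ℝ≥0) < min (s₀ : WithTop ℝ≥0) T'} →
      r ∈ {r : ℝ | 0 ≤ r ∧ (r.toNNReal : WithTop ℝ≥0) < T'} := fun r hr ↦
    ⟨hr.1, lt_of_lt_of_le hr.2 (min_le_right _ _)⟩
  have hr₀mem : r₀ ∈ {r : ℝ | 0 ≤ r ∧ (r.toNNReal : WithTop ℝ≥0) < T'} :=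
    ⟨hr₀pos.le, by simpa [hr₀] using hs₀T'⟩
  have hg_tend : Tendsto g (𝓝[E] r₀) (𝓝 (g r₀)) :=
    ((hg.continuousOn r₀ hr₀mem).mono fun r hr ↦ hD' r (hEsub hr)).tendsto
  have hu_tend : Tendsto (flowCurve W y) (𝓝[E] r₀) (𝓝 (flowCurve W y r₀)) :=
    (continuous_flowCurve hW hy).continuousAt.continuousWithinAt.tendsto
  have hg_tend' : Tendsto g (𝓝[E] r₀) (𝓝 (flowCurve W y r₀)) :=
    hu_tend.congr' (eventually_nhdsWithin_of_forall fun r hr ↦ heq (hEsub hr))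
  haveI : (𝓝[E] r₀).NeBot := by
    refine mem_closure_iff_nhdsWithin_neBot.1 ?_
    rw [hE, closure_Ico hr₀pos.ne]
    exact Set.right_mem_Icc.2 hr₀pos.le
  have hgr₀ : g r₀ = flowCurve W y r₀ := tendsto_nhds_unique hg_tend hg_tend'
  -- contradiction: the flow of `x` sits on the driving function at time `s₀`
  have hne := hg.ne hr₀pos.le hr₀mem.2
  apply hne
  rw [hgr₀, flowCurve_apply]
  have : r₀.toNNReal = s₀ := by simp [hr₀]
  rw [this, hys₀, zero_add]

/-- **Deterministic core of the SLE–Bessel bridge.** Let `W` be continuous with `W 0 = 0`,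
`x > 0`, and `y : ℝ≥0 → ℝ` continuous with `y 0 = x` satisfying the (scaled Bessel) flow equation
`y t + W t = x + ∫₀ᵗ 2/y(s) ds` for every `t` with `y > 0` on `[0, t]`. Then for every `t` before
the swallowing time of `x`, `y` is positive on `[0, t]` and `y t = Re gₜ(x) - W t`: `u = y + W` is
the Loewner flow of `x` (`isSolution_flowCurve`, `forall_pos_of_flowEq`,
`Loewner.map_eq_of_isSolution`). This is the pathwise content of Rohde–Schramm's remark
(`Y_x(t) = gₜ(x) - ξ(t)` satisfies `dY_x = (2/Y_x) dt + dξ`, proof of Lemma 6.2) and of Lawler's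
eq. (6.3), read as a characterisation. [folklore] -/
theorem pos_and_eq_re_map_sub_of_flowEq (hW : Continuous W) (hW0 : W 0 = 0) (hx : 0 < x)
    (hy : Continuous y) (hy0 : y 0 = x)
    (hflow : ∀ t : ℝ≥0, (∀ s ≤ t, 0 < y s) →
      y t + W t = x + ∫ s in (0 : ℝ)..t, 2 / y s.toNNReal)
    {t : ℝ≥0} (ht : (t : WithTop ℝ≥0) < Literature.Probability.RandomPlanarGeometry.Loewner.swallowingTime W x) :
    (∀ s ≤ t, 0 < y s) ∧ y t = (Literature.Probability.RandomPlanarGeometry.Loewner.map W t x).re - W t := by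
  have h0 : y 0 + W 0 = x := by rw [hy0, hW0, add_zero]
  refine ⟨forall_pos_of_flowEq hW hW0 hx hy hy0 hflow ht, ?_⟩
  obtain ⟨T'', ht1, ht2⟩ := exists_between ht
  obtain ⟨t'', rfl⟩ := WithTop.ne_top_iff_exists.1 (ne_top_of_lt ht2)
  have hpos'' := forall_pos_of_flowEq hW hW0 hx hy hy0 hflow ht2
  have hsol : Literature.Probability.RandomPlanarGeometry.Loewner.IsSolution W x (flowCurve W y) t'' :=
    isSolution_flowCurve hy h0 (fun s hs ↦ hpos'' s hs.le) hflow
  rw [Literature.Probability.RandomPlanarGeometry.Loewner.map_eq_of_isSolution hW hsol ht1, flowCurve_apply, Real.toNNReal_coe, Complex.ofReal_re]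
  ring

end Loewner


/-! ### Assembly: the SLE–Bessel bridge from the two facts -/

section Assembly

/-- The square root of a nonnegative real number of the form `x₀²` with `x₀ = x/√κ ≥ 0`,
multiplied back by `√κ`: `√κ √((x/√κ)²) = x` for `κ > 0`, `x ≥ 0`. [folklore] -/
theorem sqrt_mul_sqrt_sq_div {κ x : ℝ} (hκ : 0 < κ) (hx : 0 ≤ x) :
    Real.sqrt κ * Real.sqrt ((x / Real.sqrt κ) ^ 2) = x := by
  have hsκ : 0 < Real.sqrt κ := Real.sqrt_pos.2 hκ
  rw [Real.sqrt_sq (div_nonneg hx hsκ.le), mul_div_cancel₀ _ hsκ.ne']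

/-- **The SLE–Bessel bridge, reduced to its two stochastic inputs** (existence of a squared
Bessel process driven by `-B` on the canonical space with its raw Brownian filtration — fact
**E**, discharged below — and the Bessel SDE for its square root before the hitting time of `0`
— fact **S**). Given a squared Bessel process
`Z = BESQ^{1+4/κ}(x²/κ)` driven by `-B`, the process `ρ = √Z` is the Bessel process required by
`sle_bessel` (by definition of `IsBesselProcess`), and along almost every path the scaled process
`y = √κ ρ` satisfies the flow equation of `Loewner.pos_and_eq_re_map_sub_of_flowEq` (fact **S**
times `√κ`: `√κ (δ-1)/2 = 2/√κ` for `δ = 1 + 4/κ`), whence `ρ t = (Re gₜ(x) - Wₜ)/√κ` for all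
`t < T_x`.
Rohde–Schramm, *Basic properties of SLE*, Ann. of Math. 161 (2005), §6, remark after Lemma 6.2
and proof of Lemma 6.2; Lawler (2005), §6.1 eq. (6.2)–(6.3).
[cite: RohdeSchramm2005, §6 remark after Lemma 6.2] -/
theorem sle_bessel_of
    (hE : ∀ ⦃δ z₀ : ℝ⦄, 0 ≤ δ → 0 ≤ z₀ → ∃ Z : ℝ≥0 → (ℝ≥0 → ℝ) → ℝ,
      IsSquaredBesselProcess δ z₀ Z (fun t ω ↦ -Literature.Probability.Process.brownian t ω) Literature.Probability.RandomPlanarGeometry.brownianFiltration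
        Literature.Probability.Process.preWienerMeasure)
    (hS : ∀ ⦃δ z₀ : ℝ⦄ ⦃Z : ℝ≥0 → (ℝ≥0 → ℝ) → ℝ⦄, 0 ≤ δ → 0 ≤ z₀ →
      IsSquaredBesselProcess δ z₀ Z (fun t ω ↦ -Literature.Probability.Process.brownian t ω) Literature.Probability.RandomPlanarGeometry.brownianFiltration
        Literature.Probability.Process.preWienerMeasure →
      ∀ᵐ ω ∂Literature.Probability.Process.preWienerMeasure, ∀ t : ℝ≥0, (∀ s ≤ t, 0 < Z s ω) →
        Real.sqrt (Z t ω) = Real.sqrt z₀ + -Literature.Probability.Process.brownian t ω +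
          (δ - 1) / 2 * ∫ s in (0 : ℝ)..t, (Real.sqrt (Z s.toNNReal ω))⁻¹) :
    sle_bessel := by
  intro κ x hκ hx
  have hκ' : (0 : ℝ) < κ := by exact_mod_cast hκ
  have hsκ : 0 < Real.sqrt κ := Real.sqrt_pos.2 hκ'
  set δ : ℝ := 1 + 4 / (κ : ℝ) with hδdef
  have hδ : 0 ≤ δ := by positivity
  have hz₀ : 0 ≤ (x / Real.sqrt κ) ^ 2 := sq_nonneg _
  obtain ⟨Z, hZ⟩ := hE hδ hz₀
  refine ⟨fun t ω ↦ Real.sqrt (Z t ω), ⟨Z, hZ, fun _ _ ↦ rfl⟩, ?_⟩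
  have hcont : ∀ᵐ ω ∂Literature.Probability.Process.preWienerMeasure, Continuous (Z · ω) :=
    IsStrongSolution.ae_continuous
      (show IsSquaredBesselProcess δ _ Z _ Literature.Probability.RandomPlanarGeometry.brownianFiltration Literature.Probability.Process.preWienerMeasure from hZ)
  filter_upwards [hS hδ hz₀ hZ, hcont] with ω hSω hcω t ht
  -- the scaled process `y = √κ √Z` and its flow equation
  set W : ℝ≥0 → ℝ := Literature.Probability.RandomPlanarGeometry.sleDriving κ ω with hWdef
  set y : ℝ≥0 → ℝ := fun s ↦ Real.sqrt κ * Real.sqrt (Z s ω) with hydef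
  have hyc : Continuous y := continuous_const.mul (Real.continuous_sqrt.comp hcω)
  have hy0 : y 0 = x := by
    simp only [hydef]
    rw [hZ.apply_zero ω]
    exact sqrt_mul_sqrt_sq_div hκ' hx.le
  have hposZ : ∀ {s : ℝ≥0}, 0 < y s → 0 < Z s ω := by
    intro s hs
    by_contra h
    push Not at h
    have : Real.sqrt (Z s ω) = 0 := Real.sqrt_eq_zero'.2 h
    simp [hydef, this] at hs
  have hflow : ∀ t : ℝ≥0, (∀ s ≤ t, 0 < y s) →
      y t + W t = x + ∫ s in (0 : ℝ)..t, 2 / y s.toNNReal := by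
    intro t₁ hpos
    have h1 := hSω t₁ fun s hs ↦ hposZ (hpos s hs)
    set I : ℝ := ∫ s in (0 : ℝ)..t₁, (Real.sqrt (Z s.toNNReal ω))⁻¹ with hIdef
    have hI : (∫ s in (0 : ℝ)..t₁, 2 / y s.toNNReal) = 2 / Real.sqrt κ * I := by
      rw [hIdef, ← intervalIntegral.integral_const_mul]
      refine intervalIntegral.integral_congr fun s _ ↦ ?_
      simp only [hydef]
      rw [div_mul_eq_div_div, div_eq_mul_inv]
    have hx' : Real.sqrt κ * Real.sqrt ((x / Real.sqrt κ) ^ 2) = x :=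
      sqrt_mul_sqrt_sq_div hκ' hx.le
    have hκsq : Real.sqrt κ * Real.sqrt κ = κ := Real.mul_self_sqrt hκ'.le
    have hc : (δ - 1) / 2 = 2 / (κ : ℝ) := by rw [hδdef]; ring
    have hcoef : Real.sqrt κ * (2 / (κ : ℝ)) = 2 / Real.sqrt κ := by
      have h2 : (2 : ℝ) / κ = 2 / (Real.sqrt κ * Real.sqrt κ) := by rw [hκsq]
      rw [h2, div_mul_eq_div_div, mul_div_cancel₀ _ hsκ.ne']
    rw [hI]
    simp only [hydef, hWdef, Literature.Probability.RandomPlanarGeometry.sleDriving_apply]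
    rw [h1, hc]
    have hfinal : Real.sqrt κ * (Real.sqrt ((x / Real.sqrt κ) ^ 2) + -Literature.Probability.Process.brownian t₁ ω +
        2 / (κ : ℝ) * I) + Real.sqrt κ * Literature.Probability.Process.brownian t₁ ω =
        Real.sqrt κ * Real.sqrt ((x / Real.sqrt κ) ^ 2) + Real.sqrt κ * (2 / (κ : ℝ)) * I := by
      ring
    rw [hfinal, hx', hcoef]
  have key := Loewner.pos_and_eq_re_map_sub_of_flowEq (Literature.Probability.RandomPlanarGeometry.continuous_sleDriving κ ω)
    (Literature.Probability.RandomPlanarGeometry.sleDriving_zero κ ω) hx hyc hy0 hflow ht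
  -- conclusion
  have h2 : Real.sqrt κ * Real.sqrt (Z t ω) = (Literature.Probability.RandomPlanarGeometry.Loewner.map W t x).re - W t := key.2
  rw [eq_div_iff hsκ.ne', mul_comm]
  exact h2

/-- **The SLE–Bessel bridge, reduced to the Bessel SDE before `T₀`** (fact **S**): since squared
Bessel processes driven by `-B` exist (`exists_isSquaredBesselProcess_neg_brownian`), `sle_bessel`
follows from the statement that for every `BESQ^δ(z₀)` process `Z` driven by `-B` (`δ, z₀ ≥ 0`),
almost surely, for all `t` with `Z > 0` on `[0, t]`,
`√Zₜ = √z₀ - Bₜ + ((δ - 1)/2) ∫₀ᵗ (√Z_s)⁻¹ ds` — Itô's formula for `√·` before the hitting time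
of `0` (Revuz–Yor, Ch. XI, §1, p. 446, display after Def. (1.9), and p. 442 for the
localisation), which is Lawler's definition of the Bessel process (§1.10).
Rohde–Schramm, *Basic properties of SLE*, Ann. of Math. 161 (2005), §6, remark after Lemma 6.2;
Lawler (2005), §6.1 eq. (6.2)–(6.3); Revuz–Yor (1999), Ch. XI §1.
[cite: RohdeSchramm2005, §6 remark after Lemma 6.2] -/
theorem sle_bessel_of_sqrt_eq
    (hS : ∀ ⦃δ z₀ : ℝ⦄ ⦃Z : ℝ≥0 → (ℝ≥0 → ℝ) → ℝ⦄, 0 ≤ δ → 0 ≤ z₀ →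
      IsSquaredBesselProcess δ z₀ Z (fun t ω ↦ -Literature.Probability.Process.brownian t ω) Literature.Probability.RandomPlanarGeometry.brownianFiltration
        Literature.Probability.Process.preWienerMeasure →
      ∀ᵐ ω ∂Literature.Probability.Process.preWienerMeasure, ∀ t : ℝ≥0, (∀ s ≤ t, 0 < Z s ω) →
        Real.sqrt (Z t ω) = Real.sqrt z₀ + -Literature.Probability.Process.brownian t ω +
          (δ - 1) / 2 * ∫ s in (0 : ℝ)..t, (Real.sqrt (Z s.toNNReal ω))⁻¹) :
    sle_bessel :=
  sle_bessel_of (fun δ z₀ _ _ ↦ exists_isSquaredBesselProcess_neg_brownian δ z₀) hS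

end Assembly

end Literature.Analysis.FunctionSpaces
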